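import Mathlib.Analysis.InnerProductSpace.Basic
import HarnessLib

/-!
# A dense subspace meets every finite-codimension orthogonal complement densely
# («trial vectors may be taken in a core»: the technical step of Reed–Simon IV, Thm XIII.2)

Topic `Literature/Analysis/InnerProduct` (next to `SubspaceLeakage`, `CourantFischerBounds`; companion of
`OperatorTheory/SecondLevelGapDense.exists_mem_rayleigh_gt`, the one-constraint case).  Setting: an inner product space `E` over `𝕜 = ℝ, ℂ`
(no completeness), a DENSE subspace `D`, finitely many constraint vectors `v ∈ s` (arbitrary vectors of `E`, not necessarily in `D`, not
necessarily independent).  Result (★ `exists_mem_forall_inner_eq_zero_norm_sub_lt`): every `x ⊥ s` is approximated by vectors `d ∈ D` with `d ⊥ s`: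
`∀ ε > 0, ∃ d ∈ D, (∀ v ∈ s, ⟪v, d⟫ = 0) ∧ ‖d − x‖ < ε` — i.e. `D ∩ s^⊥` is dense in `s^⊥`.  Proof by induction on `s`, one constraint at a time:
either the new vector `a` annihilates `D ∩ s^⊥` (nothing to do), or some `d₀ ∈ D ∩ s^⊥` has `⟪a, d₀⟫ ≠ 0` and one corrects an approximant `d` by the
multiple `(⟪a,d⟫/⟪a,d₀⟫)·d₀`, of norm `≤ ‖a‖‖d₀‖/|⟪a,d₀⟫| · ‖d − x‖` because `⟪a, d⟫ = ⟪a, d − x⟫`.  This is the step that lets the min–max principle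
be run with trial vectors in a form core / dense domain while the `n − 1` constraint vectors are arbitrary (Reed–Simon IV Thm XIII.2, «by mimicking the
proof of Theorem XIII.1»).  Family form for `φ : Fin k → E` (★ `exists_mem_forall_inner_eq_zero_norm_sub_lt_of_fin`), the shape of the cell's
`levelValue … k` constraints.  All PROVED; no definitions, no named facts.

## References
* M. Reed, B. Simon, *Methods of Modern Mathematical Physics IV*, Academic Press 1978, §XIII.1, Thm XIII.2 (held p0084). [ReedSimonIV1978]
-/

set_option autoImplicit false

open scoped InnerProductSpace

namespace Literature.Analysis.InnerProduct.DenseInter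

variable {𝕜 : Type*} [RCLike 𝕜] {E : Type*} [NormedAddCommGroup E] [InnerProductSpace 𝕜 E]

/-- Density of a subspace, metric form: every `x` has points of `D` within any `ε > 0`. [folklore] -/
private theorem exists_mem_norm_sub_lt_of_dense (D : Submodule 𝕜 E) (hD : Dense (D : Set E)) (x : E) {ε : ℝ} (hε : 0 < ε) :
    ∃ d ∈ D, ‖d - x‖ < ε := by
  obtain ⟨d, hd, hdD⟩ := Metric.dense_iff.mp hD x ε hε
  exact ⟨d, hdD, by rwa [Metric.mem_ball, dist_eq_norm] at hd⟩

/-- ★ **`D ∩ s^⊥` is dense in `s^⊥`** for a dense subspace `D` and a FINITE set `s` of constraint vectors: every `x` with `⟪v, x⟫ = 0` for all `v ∈ s`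
is within any `ε > 0` of some `d ∈ D` with `⟪v, d⟫ = 0` for all `v ∈ s`. [cite: ReedSimonIV1978, Thm XIII.2] -/
theorem exists_mem_forall_inner_eq_zero_norm_sub_lt [DecidableEq E] (D : Submodule 𝕜 E) (hD : Dense (D : Set E))
    (s : Finset E) {x : E} (hx : ∀ v ∈ s, ⟪v, x⟫_𝕜 = 0) {ε : ℝ} (hε : 0 < ε) :
    ∃ d ∈ D, (∀ v ∈ s, ⟪v, d⟫_𝕜 = 0) ∧ ‖d - x‖ < ε := by
  induction s using Finset.induction_on generalizing x ε with
  | empty =>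
    obtain ⟨d, hdD, hd⟩ := exists_mem_norm_sub_lt_of_dense D hD x hε
    exact ⟨d, hdD, fun v hv => absurd hv (Finset.notMem_empty v), hd⟩
  | @insert a s ha ih =>
    have hxs : ∀ v ∈ s, ⟪v, x⟫_𝕜 = 0 := fun v hv => hx v (Finset.mem_insert_of_mem hv)
    have hxa : ⟪a, x⟫_𝕜 = 0 := hx a (Finset.mem_insert_self a s)
    by_cases hcase : ∃ d₀ ∈ D, (∀ v ∈ s, ⟪v, d₀⟫_𝕜 = 0) ∧ ⟪a, d₀⟫_𝕜 ≠ 0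
    · -- correct an approximant along `d₀`
      obtain ⟨d₀, hd₀D, hd₀s, hd₀a⟩ := hcase
      set M : ℝ := ‖a‖ * ‖d₀‖ / ‖⟪a, d₀⟫_𝕜‖ with hM
      have hM0 : 0 ≤ M := by positivity
      have hε' : 0 < ε / (1 + M) := by positivity
      obtain ⟨d, hdD, hds, hd⟩ := ih hxs hε'
      set c : 𝕜 := ⟪a, d⟫_𝕜 / ⟪a, d₀⟫_𝕜 with hc
      refine ⟨d - c • d₀, D.sub_mem hdD (D.smul_mem c hd₀D), fun v hv => ?_, ?_⟩
      · rcases Finset.mem_insert.mp hv with rfl | hv'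
        · rw [inner_sub_right, inner_smul_right, hc, div_mul_cancel₀ _ hd₀a, sub_self]
        · rw [inner_sub_right, inner_smul_right, hds v hv', hd₀s v hv', mul_zero, sub_zero]
      · -- `‖(d − c d₀) − x‖ ≤ ‖d − x‖ + ‖c‖‖d₀‖ ≤ (1 + M)‖d − x‖ < ε`
        have hinner : ⟪a, d⟫_𝕜 = ⟪a, d - x⟫_𝕜 := by rw [inner_sub_right, hxa, sub_zero]
        have hcn : ‖c‖ * ‖d₀‖ ≤ M * ‖d - x‖ := by
          rw [hc, norm_div, hinner, hM]
          have h1 : ‖⟪a, d - x⟫_𝕜‖ ≤ ‖a‖ * ‖d - x‖ := norm_inner_le_norm a (d - x)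
          have hpos : 0 < ‖⟪a, d₀⟫_𝕜‖ := norm_pos_iff.mpr hd₀a
          calc ‖⟪a, d - x⟫_𝕜‖ / ‖⟪a, d₀⟫_𝕜‖ * ‖d₀‖ ≤ ‖a‖ * ‖d - x‖ / ‖⟪a, d₀⟫_𝕜‖ * ‖d₀‖ := by gcongr
            _ = ‖a‖ * ‖d₀‖ / ‖⟪a, d₀⟫_𝕜‖ * ‖d - x‖ := by ring
        calc ‖d - c • d₀ - x‖ = ‖(d - x) - c • d₀‖ := by abel_nf
          _ ≤ ‖d - x‖ + ‖c • d₀‖ := norm_sub_le _ _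
          _ = ‖d - x‖ + ‖c‖ * ‖d₀‖ := by rw [norm_smul]
          _ ≤ ‖d - x‖ + M * ‖d - x‖ := by linarith
          _ = (1 + M) * ‖d - x‖ := by ring
          _ < (1 + M) * (ε / (1 + M)) := by gcongr
          _ = ε := by field_simp
    · -- `a` annihilates `D ∩ s^⊥`: the old approximants already satisfy the new constraint
      push Not at hcase
      obtain ⟨d, hdD, hds, hd⟩ := ih hxs hε
      refine ⟨d, hdD, fun v hv => ?_, hd⟩
      rcases Finset.mem_insert.mp hv with rfl | hv'
      · exact hcase d hdD hds
      · exact hds v hv'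

/-- ★ Family form (the shape of `k` min–max constraints `φ₀, …, φ_{k−1}`): for a dense subspace `D` and any `φ : Fin k → E`, every `x` orthogonal to
all `φ i` is within any `ε > 0` of some `d ∈ D` orthogonal to all `φ i`. [cite: ReedSimonIV1978, Thm XIII.2] -/
theorem exists_mem_forall_inner_eq_zero_norm_sub_lt_of_fin (D : Submodule 𝕜 E) (hD : Dense (D : Set E))
    {k : ℕ} (φ : Fin k → E) {x : E} (hx : ∀ i, ⟪φ i, x⟫_𝕜 = 0) {ε : ℝ} (hε : 0 < ε) :
    ∃ d ∈ D, (∀ i, ⟪φ i, d⟫_𝕜 = 0) ∧ ‖d - x‖ < ε := by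
  classical
  set s : Finset E := Finset.univ.image φ with hs
  have hxs : ∀ v ∈ s, ⟪v, x⟫_𝕜 = 0 := by
    intro v hv
    obtain ⟨i, -, rfl⟩ := Finset.mem_image.mp hv
    exact hx i
  obtain ⟨d, hdD, hds, hd⟩ := exists_mem_forall_inner_eq_zero_norm_sub_lt D hD s hxs hε
  exact ⟨d, hdD, fun i => hds (φ i) (Finset.mem_image.mpr ⟨i, Finset.mem_univ i, rfl⟩), hd⟩

/-- Consequence for suprema of CONTINUOUS functionals (e.g. a Rayleigh quotient away from `0`): if `g : E → ℝ` is continuous at `x ⊥ s`, then for every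
`η > 0` there is `d ∈ D`, `d ⊥ s`, with `g x − η < g d`.  So `sup {g ψ : ψ ∈ D ∩ s^⊥} ≥ g x` for every `x ∈ s^⊥` at which `g` is continuous.
[cite: ReedSimonIV1978, Thm XIII.2] -/
theorem exists_mem_forall_inner_eq_zero_lt_apply [DecidableEq E] (D : Submodule 𝕜 E) (hD : Dense (D : Set E))
    (s : Finset E) {x : E} (hx : ∀ v ∈ s, ⟪v, x⟫_𝕜 = 0) {g : E → ℝ} (hg : ContinuousAt g x) {η : ℝ} (hη : 0 < η) :
    ∃ d ∈ D, (∀ v ∈ s, ⟪v, d⟫_𝕜 = 0) ∧ g x - η < g d := by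
  obtain ⟨δ, hδ, hδg⟩ := Metric.continuousAt_iff.mp hg η hη
  obtain ⟨d, hdD, hds, hd⟩ := exists_mem_forall_inner_eq_zero_norm_sub_lt D hD s hx hδ
  refine ⟨d, hdD, hds, ?_⟩
  have h := hδg (by rwa [dist_eq_norm])
  rw [Real.dist_eq] at h
  have := (abs_lt.mp h).1
  linarith

end Literature.Analysis.InnerProduct.DenseInter
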